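import Summits.BirchSwinnertonDyer.BirchSwinnertonDyer.Theorems.ClassRecordThreeShimuraKolyvaginOrderBoundAtThreeSurjLocalShift
import Summits.BirchSwinnertonDyer.BirchSwinnertonDyer.Theorems.ErratumRoadFiveShimuraKolyvaginOrderBoundInertReciprocity
import HarnessLib

/-!
# Crux `ShimuraKolyvaginOrderBoundAtThreeSurj` (item stmt-BirchSwinnertonDyer-19899; K2@3 + KOLY residual) — the
# UNIT-INDEX slice (`3 ∤ [E(K) : ℤP]`, Kolyvagin's `m₀ = 0`) of the crux as ONE kernel theorem modulo the
# ring-class-rational Shimura Euler-system carrier and Poitou–Tate, on the Kodaira–Néron sub-locus at `3`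

Cell `bsd-stepL` (run/shared/lean/pub/bsd-stepL/), seat `bsd-stepL-shim3a` (prover g2, PART 1b ACCEL row (6)),
HELPER for `Summit.BirchSwinnertonDyer.BirchSwinnertonDyer.Theses.ClassRecordThree.ShimuraKolyvaginOrderBoundAtThreeSurj`
(`--supports stmt-BirchSwinnertonDyer-19899 --as helper`; skeleton v2 e3c96ff7: stubs
`stub_orderBoundSurj_adicOntoAtThree` ∕ `…adicDefectAtThree`). The `p = 3` reading of shim-p1's
`…InertMachineEntry` §4 (p470900) and `…InertReciprocity` §3 (p471634) — both general in `p` except for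
their local leaf (`5 ≤ p`) — with the local leaf replaced by this seat's `p = 3` leaf
`ShimuraKolyvaginLocalShift.kolyvaginClass_mem_selmerLocalKer_of_ringClassRational_three` (p477215).

## What this file proves

* `sha_primary_eq_zero_of_ringClassRationalPointsM_three` — **`Ш(E/K)[3^∞] = 0` from `P ∉ 3E(K)`,
  ring-class-rational Euler-system data `hpointsR` at `3` and Kolyvagin reciprocity (R)_M `hR` at `3`**, on
  the crux's binders (`W` globally minimal of conductor `N`, `ρ̄_{E,3}` onto — the crux's `Surj W 3` —, `K`
  imaginary quadratic, `hin` ∕ `hsp` VERBATIM) + the ℚ-side Kodaira–Néron clause at `3`: `hTam` (every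
  multiplicative `ℓ ∉ S`, THE PRIME 3 INCLUDED, has `3 ∤ ord_ℓ Δ_min(E/ℚ)`) and `hKod` (every additive prime
  of `E` has Kodaira type `∉ {IV, IV*}`). Proof = x11b3's machine entry keyed on the conductor (shim-p1's
  `sha_primary_eq_zero_at_of_pointsM_of_reciprocityM_of_not_dvd_of_conductorNorm`) with clause (d) of
  `hpoints` SUPPLIED at every Kolyvagin level by the `p = 3` local leaf.
* `natCard_primaryComponent_sha_le_of_ringClassRationalPointsM_of_poitouTate_three` — **the crux's
  conclusion `#Ш(E/K)[3^∞] ≤ 3^(2·ord₃[E(K):ℤP])` (here `= 1`) on its unit-index slice**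
  (`padicValNat 3 [E(K):ℤP] = 0` with the guard `0 < [E(K):ℤP]`), from `hpointsR` and the Poitou–Tate named
  fact `hPT` ((R)_M from it by shim-p1's `kolyvaginReciprocityM_of_poitouTate_of_conductorNorm`).

## Honest framing

THEOREMS ONLY (no `def`, no named fact, no `sorry`; axioms standard). This is NOT stub A ∕ B and NOT the crux:
(a) it is the `m₀ = 0` slice only (the ORDER form for `3 ∣ [E(K):ℤP]` needs x11b3's ORDER machine re-keyed
on the conductor + its Cassels–Tate inputs — not done); (b) it is CONDITIONAL on `hpointsR` — the Shimura
CM-point Euler system of `X_{N⁺,N⁻}` in ring-class-rationality currency (Bertolini–Darmon 1996 §2.3–2.6,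
Nekovář 2007 (4.8)–(4.13), Cai–Shu–Tian 2014: printed with proofs; carrier port in progress by shim-p1,
LOCAL-HALF-19718.md §6) — and on `hPT`; (c) it carries the Kodaira–Néron clause `hTam ∧ hKod` at `3`, which
is NOT a clause of item 19899 (off that sub-locus the level-shift leaf `…_of_ringClassRational_shift` needs
Kolyvagin primes one level deeper than the machine's Čebotarev step supplies); (d) the crux's data
`Dt X W' P₀ degS` and its Gross–Zagier display are not used (they serve the consumers' degree bookkeeping;
transport between displayed points is shim3a g0's p468392). Item 19899 stays OPEN. BSD is not proved by any
of this; no census number moves.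

## References

[cite: GrossLMS1991, §1 Thm. 1.3 (2), Prop. 2.1 (2), §§3–8, §10] [cite: McCallumLMS1991, §1 Theorem, §§4–5, Lemma 5.1]
[cite: BertoliniDarmon1996, §2.3–2.6, Prop. 2.6] [cite: Nekovar2007, (4.8)–(4.13), (5.12)]
[cite: MilneADT2006, Ch. I Prop. 3.8, Thm. 4.10(b)] [cite: SilvermanAEC2009, Thm. VII.6.1]
Cell files: HOME/shim/LOCAL-HALF-19718.md (shim-p1 g7), HOME/shim/SHIM3A-MEMO-19616.md (shim3a g0),
HOME/shim/S1S2-ROAD-19718.md (shim-p1 g6).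
presearch: «Kolyvagin m₀ = 0 (Ш[p^∞] = 0 from y ∉ pE(K)) for Shimura-curve Heegner points at p = 3 ∣ N» →
[corpus: book:editornd-l-functions-arithmetic, Gross 1991 Prop. 2.1 (2)] (X₀(N), any odd surjective p);
[corpus: Darmon CBMS 101 Thm. 10.2] (p ∤ 6N); D-AUDIT-19526c4 Table C (lit g9): no row at (3 ∣ N⁺, N⁻ > 1) —
corpus + galaxy, queries of SHIM3A-MEMO §6; tree `lean search 'RationalPointsM_three'` → none.
-/

noncomputable section

open scoped Classical AddSubgroup
set_option linter.dupNamespace false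
namespace Summit.BirchSwinnertonDyer.BirchSwinnertonDyer.Theorems.ShimuraKolyvaginLocalShift

open WeierstrassCurve NumberField IsDedekindDomain Field
  Literature.NumberTheory.EllipticCurves Literature.NumberTheory.EllipticCurves.KolyvaginCocycle
  Literature.NumberTheory.EllipticCurves.KolyvaginDescent
  Literature.NumberTheory.EllipticCurves.RingClassField
  Literature.NumberTheory.GaloisRepresentations Literature.NumberTheory.GaloisCohomology
  Literature.NumberTheory.NumberFields Literature.NumberTheory.DiophantineGeometry
  Summit.BirchSwinnertonDyer.BirchSwinnertonDyer.Theorems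

variable {K : Type} [Field K] [NumberField K]

/-- **`Ш(E/K)[3^∞] = 0` from `P ∉ 3E(K)`, RING-CLASS-RATIONAL Euler-system data at `3`, and Kolyvagin
reciprocity at `3`, on the Kodaira–Néron sub-locus of the crux's locus** (the `p = 3` twin of shim-p1's
`sha_primary_eq_zero_of_ringClassRationalPointsM`, p470900 §4). Binders: the crux's `W` (globally minimal,
conductor `N`), `ρ̄_{E,3}` onto, `K` imaginary quadratic with `ι : K → ℂ`, the inert set `S` with the crux's
clauses `hin` ∕ `hsp` VERBATIM; the ℚ-side Kodaira–Néron clause at `3` (`hTam`: `3 ∤ ord_ℓ Δ_min(E/ℚ)` at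
every multiplicative `ℓ ∉ S`, the prime `3` included; `hKod`: Kodaira type `∉ {IV, IV*}` at every additive
prime); a non-torsion `P ∈ E(K)` with `3 ∤ P` in `E(K)`; `hpointsR` — the machine's leaf (A′) `hpoints` with
its Selmer clause (d) REPLACED by ring-class rationality data (`emb m : K[m] → K̄`, every point of `A_m`
rational over `emb m (K[m])`; printed `A_m = E(K[m])`, Bertolini–Darmon 1996 §2.3–2.5 for `X_{N⁺,N⁻}`), the
other clauses (sign `ε`, lift `τ`, `τ`-stability, `P_1 = P`, Gross 5.4 (1), McCallum 4.4) verbatim; (R)_M `hR`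
verbatim. Conclusion: every element of `Ш(E/K)` killed by a power of `3` is `0`. Proof: shim-p1's
conductor-keyed entry `sha_primary_eq_zero_at_of_pointsM_of_reciprocityM_of_not_dvd_of_conductorNorm` with
clause (d) SUPPLIED by `kolyvaginClass_mem_selmerLocalKer_of_ringClassRational_three` (p477215) at every
Kolyvagin level. HONEST: conditional on (a) the Shimura carrier in this currency, (b) (R)_M at `3`, (c) the
Kodaira–Néron clause; item 19899 stays OPEN. [cite: GrossLMS1991, §1 Thm. 1.3 (2), Prop. 2.1 (2), §§3–8, §10]
[cite: McCallumLMS1991, §1, §§4–5] [cite: BertoliniDarmon1996, §2.3–2.6, Prop. 2.6] -/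
theorem sha_primary_eq_zero_of_ringClassRationalPointsM_three
    (W : WeierstrassCurve ℚ) [W.IsElliptic] [W.IsGloballyMinimal] {N : ℕ} [NeZero N]
    (hN : W.conductorNorm ℤ = N) (hρ : W.HasSurjectiveModNGaloisRep 3) (hK : IsImaginaryQuadratic K)
    (ι : K →+* ℂ) {S : Finset ℕ}
    (hin : ∀ ℓ ∈ S, ℓ.Prime ∧ ℓ ∣ N ∧ ¬ ℓ ^ 2 ∣ N ∧
      ((Ideal.span {(ℓ : ℤ)}).primesOver (𝓞 K)).ncard = 1 ∧ ¬ (ℓ : ℤ) ∣ NumberField.discr K)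
    (hsp : ∀ ℓ : ℕ, ℓ.Prime → ℓ ∣ N → ℓ ∉ S → ((Ideal.span {(ℓ : ℤ)}).primesOver (𝓞 K)).ncard = 2)
    (hTam : ∀ (ℓ : ℕ) [Fact ℓ.Prime], ℓ ∉ S → W.HasMultiplicativeReductionAtPrime ℓ →
      ¬ 3 ∣ padicValInt ℓ W.minimalDiscriminantInt)
    (hKod : ∀ u : HeightOneSpectrum (𝓞 ℚ), W.HasAdditiveReductionAt u →
      W.kodairaSymbolAt u ≠ KodairaSymbol.IV ∧ W.kodairaSymbolAt u ≠ KodairaSymbol.IVstar)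
    {P : (W.baseChange K).toAffine.Point} (hnt : ¬ IsOfFinAddOrder P)
    (hndvd : ∀ Q : (W.baseChange K).toAffine.Point, 3 • Q ≠ P)
    (hpointsR : ∀ {M : ℕ} (_hM : 1 ≤ M)
      (hdiv : ∀ Q : geomPoints (W.baseChange K), ∃ R, ((3 ^ M : ℕ) : ℤ) • R = Q)
      (c : K ≃ₐ[ℚ] K) (_hc : c ≠ 1),
      ∃ (ε : ℤ) (τ : AlgebraicClosure K ≃+* AlgebraicClosure K) (hτ : IsLiftOfAut c τ)
        (A : ℕ → AddSubgroup (geomPoints (W.baseChange K)))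
        (hA : ∀ m, KolyvaginCocycle.IsAdmissible (Field.absoluteGaloisGroup K) (A m)
          ((3 ^ M : ℕ) : ℤ))
        (emb : ∀ m : ℕ, ringClassField K ι m →ₐ[K] AlgebraicClosure K)
        (Pt : ℕ → geomPoints (W.baseChange K))
        (hPt : ∀ m, Pt m ∈
          KolyvaginCocycle.invPoints (Field.absoluteGaloisGroup K) (A m) ((3 ^ M : ℕ) : ℤ)),
        (ε = 1 ∨ ε = -1) ∧
        IsOfFinAddOrder (Affine.Point.map (W' := W) (c : K →ₐ[ℚ] K) P - ε • P) ∧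
        (∀ m, ∀ a ∈ A m, hτ.pointsMap W a ∈ A m) ∧
        Pt 1 = toGeomPoints (W.baseChange K) P ∧
        (∀ m, m ≠ 0 → ∀ a ∈ A m, ∀ Φ : Field.absoluteGaloisGroup K,
          (∀ x : ringClassField K ι m, Φ • emb m x = emb m x) → Φ • a = a) ∧
        (∀ m : ℕ, Squarefree m →
          (∀ q ∈ m.primeFactors, IsKolyvaginPrime N W K 3 q ∧ FrobEqFrobInfty W K (3 ^ M) q) →
          (∃ B ∈ A m, hτ.pointsMap W (Pt m) =
            (ε * (-1) ^ m.primeFactors.card) • Pt m + ((3 ^ M : ℕ) : ℤ) • B) ∧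
          (∀ ℓ : ℕ, ℓ.Prime → ℓ ∣ m → ∀ v : HeightOneSpectrum (𝓞 K), (ℓ : 𝓞 K) ∈ v.asIdeal →
            ∀ a : ℕ, (((3 : ℤ) ^ a) •
                kolyvaginClass (W.baseChange K) _ hdiv (hA m) (Pt m) (hPt m) ∈
                selmerLocalKer (W.baseChange K) (v.adicCompletion K) ((3 ^ M : ℕ) : ℤ) ↔
              ((3 : ℤ) ^ a) • kolyvaginClass (W.baseChange K) _ hdiv (hA (m / ℓ)) (Pt (m / ℓ))
                  (hPt (m / ℓ)) ∈
                (W.baseChange K).torsionLocalKer (v.adicCompletion K) ((3 ^ M : ℕ) : ℤ)))))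
    (hR : ∀ {M : ℕ} (_hM : 1 ≤ M) {ℓ : ℕ} (hℓ : IsKolyvaginPrime N W K 3 ℓ),
      FrobEqFrobInfty W K (3 ^ M) ℓ →
      ∃ (A : Type) (_ : AddCommGroup A)
        (e : geomTorsion (W.baseChange K) ((3 ^ M : ℕ) : ℤ) →+
          geomTorsion (W.baseChange K) ((3 ^ M : ℕ) : ℤ) →+ A),
        (∀ x, e x x = 0) ∧ (∀ x, (∀ y, e x y = 0) → x = 0) ∧
        ∀ s ∈ selmerGroup (W.baseChange K) ((3 ^ M : ℕ) : ℤ),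
          ∀ c' : galH1Torsion (W.baseChange K) ((3 ^ M : ℕ) : ℤ),
          (∀ v : HeightOneSpectrum (𝓞 K), (ℓ : 𝓞 K) ∉ v.asIdeal →
            c' ∈ selmerLocalKer (W.baseChange K) (v.adicCompletion K) ((3 ^ M : ℕ) : ℤ)) →
          (∀ w : InfinitePlace K,
            c' ∈ selmerLocalKer (W.baseChange K) w.Completion ((3 ^ M : ℕ) : ℤ)) →
          ∀ 𝔔 ∈ hℓ.place.primesAbove, ∀ F : Field.absoluteGaloisGroup K,
            IsArithFrobAt (𝓞 K) F 𝔔 →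
            F ∈ torsionFixing (W.baseChange K) ((3 ^ M : ℕ) : ℤ) →
            ∀ σ ∈ 𝔔.inertia (Field.absoluteGaloisGroup K),
            e (h1Eval (W.baseChange K) ((3 ^ M : ℕ) : ℤ) s F)
              (h1Eval (W.baseChange K) ((3 ^ M : ℕ) : ℤ) c' σ) = 0) :
    ∀ d : (W.baseChange K).sha, (∃ j : ℕ, 3 ^ j • d = 0) → d = 0 := by
  refine sha_primary_eq_zero_at_of_pointsM_of_reciprocityM_of_not_dvd_of_conductorNorm W hN hK hnt
    Nat.prime_three (by decide) hρ hndvd ?_ hR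
  intro M hM hdiv c hc
  obtain ⟨ε, τ, hτ, A, hA, emb, Pt, hPt, hε, h53, hAτ, hPt1, hrat, hm'⟩ := hpointsR hM hdiv c hc
  refine ⟨ε, τ, hτ, A, hA, Pt, hPt, hε, h53, hAτ, hPt1, fun m hm hk ↦ ⟨(hm' m hm hk).1, ?_, (hm' m hm hk).2⟩⟩
  intro v hv
  exact kolyvaginClass_mem_selmerLocalKer_of_ringClassRational_three hK ι (Squarefree.ne_zero hm) (emb m) W
    hN hin hsp hTam hKod (fun q hq ↦ (hk q hq).1.2.1) (hA m) (hrat m (Squarefree.ne_zero hm)) (hPt m) v hv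

/-- **The crux's conclusion on its UNIT-INDEX slice at `3`, `#Ш(E/K)[3^∞] ≤ 3^(2·ord₃[E(K):ℤP])` (here
`= 1`), from the ring-class-rational Euler-system data and the Poitou–Tate named fact, on the Kodaira–Néron
sub-locus** (the `p = 3` twin of shim-p1's
`natCard_primaryComponent_sha_le_of_ringClassRationalPointsM_of_poitouTate`, p471634 §3). Binders: the crux's
(`W` globally minimal of conductor `N`, `ρ̄_{E,3}` onto, `K` imaginary quadratic, `hin`, `hsp`) + `ι : K → ℂ` +
the Kodaira–Néron clause `hTam ∧ hKod` at `3` + `P ∈ E(K)` non-torsion with `padicValNat 3 [E(K):ℤP] = 0`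
AND the guard `0 < [E(K):ℤP]` + `hpointsR` + `hPT` (Poitou–Tate, cite-only named fact ⇒ CONDITIONAL).
Proof: (R)_M at `3` from `hPT` (shim-p1's `kolyvaginReciprocityM_of_poitouTate_of_conductorNorm`),
`P ∉ 3E(K)` from the index (shim-p1's `nsmul_ne_of_padicValNat_index_eq_zero`), `Ш(E/K)[3^∞] = 0` from
`sha_primary_eq_zero_of_ringClassRationalPointsM_three`; the `3`-primary component is `⊥`. HONEST: item
19899 stays OPEN — the gap from this theorem to the crux ON THE UNIT-INDEX ∧ KODAIRA–NÉRON SLICE is exactly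
{`hpointsR` (printed carrier, port in progress), `hPT`, the slice clauses, `0 < index`}; the ORDER form
(`3 ∣ index`) is not touched here. [cite: GrossLMS1991, Prop. 2.1 (2)]
[cite: McCallumLMS1991, §1 Theorem (Kolyvagin), Lemma 5.1] [cite: MilneADT2006, Ch. I Thm. 4.10(b)] -/
theorem natCard_primaryComponent_sha_le_of_ringClassRationalPointsM_of_poitouTate_three
    (hPT : poitouTate_sum_localTatePairing_eq_zero K)
    (W : WeierstrassCurve ℚ) [W.IsElliptic] [W.IsGloballyMinimal] {N : ℕ} [NeZero N]
    (hN : W.conductorNorm ℤ = N) (hρ : W.HasSurjectiveModNGaloisRep 3) (hK : IsImaginaryQuadratic K)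
    (ι : K →+* ℂ) {S : Finset ℕ}
    (hin : ∀ ℓ ∈ S, ℓ.Prime ∧ ℓ ∣ N ∧ ¬ ℓ ^ 2 ∣ N ∧
      ((Ideal.span {(ℓ : ℤ)}).primesOver (𝓞 K)).ncard = 1 ∧ ¬ (ℓ : ℤ) ∣ NumberField.discr K)
    (hsp : ∀ ℓ : ℕ, ℓ.Prime → ℓ ∣ N → ℓ ∉ S → ((Ideal.span {(ℓ : ℤ)}).primesOver (𝓞 K)).ncard = 2)
    (hTam : ∀ (ℓ : ℕ) [Fact ℓ.Prime], ℓ ∉ S → W.HasMultiplicativeReductionAtPrime ℓ →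
      ¬ 3 ∣ padicValInt ℓ W.minimalDiscriminantInt)
    (hKod : ∀ u : HeightOneSpectrum (𝓞 ℚ), W.HasAdditiveReductionAt u →
      W.kodairaSymbolAt u ≠ KodairaSymbol.IV ∧ W.kodairaSymbolAt u ≠ KodairaSymbol.IVstar)
    {P : (W.baseChange K).toAffine.Point} (hnt : ¬ IsOfFinAddOrder P)
    (hidx0 : 0 < (AddSubgroup.zmultiples P).index)
    (hidx : padicValNat 3 (AddSubgroup.zmultiples P).index = 0)
    (hpointsR : ∀ {M : ℕ} (_hM : 1 ≤ M)
      (hdiv : ∀ Q : geomPoints (W.baseChange K), ∃ R, ((3 ^ M : ℕ) : ℤ) • R = Q)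
      (c : K ≃ₐ[ℚ] K) (_hc : c ≠ 1),
      ∃ (ε : ℤ) (τ : AlgebraicClosure K ≃+* AlgebraicClosure K) (hτ : IsLiftOfAut c τ)
        (A : ℕ → AddSubgroup (geomPoints (W.baseChange K)))
        (hA : ∀ m, KolyvaginCocycle.IsAdmissible (Field.absoluteGaloisGroup K) (A m)
          ((3 ^ M : ℕ) : ℤ))
        (emb : ∀ m : ℕ, ringClassField K ι m →ₐ[K] AlgebraicClosure K)
        (Pt : ℕ → geomPoints (W.baseChange K))
        (hPt : ∀ m, Pt m ∈
          KolyvaginCocycle.invPoints (Field.absoluteGaloisGroup K) (A m) ((3 ^ M : ℕ) : ℤ)),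
        (ε = 1 ∨ ε = -1) ∧
        IsOfFinAddOrder (Affine.Point.map (W' := W) (c : K →ₐ[ℚ] K) P - ε • P) ∧
        (∀ m, ∀ a ∈ A m, hτ.pointsMap W a ∈ A m) ∧
        Pt 1 = toGeomPoints (W.baseChange K) P ∧
        (∀ m, m ≠ 0 → ∀ a ∈ A m, ∀ Φ : Field.absoluteGaloisGroup K,
          (∀ x : ringClassField K ι m, Φ • emb m x = emb m x) → Φ • a = a) ∧
        (∀ m : ℕ, Squarefree m →
          (∀ q ∈ m.primeFactors, IsKolyvaginPrime N W K 3 q ∧ FrobEqFrobInfty W K (3 ^ M) q) →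
          (∃ B ∈ A m, hτ.pointsMap W (Pt m) =
            (ε * (-1) ^ m.primeFactors.card) • Pt m + ((3 ^ M : ℕ) : ℤ) • B) ∧
          (∀ ℓ : ℕ, ℓ.Prime → ℓ ∣ m → ∀ v : HeightOneSpectrum (𝓞 K), (ℓ : 𝓞 K) ∈ v.asIdeal →
            ∀ a : ℕ, (((3 : ℤ) ^ a) •
                kolyvaginClass (W.baseChange K) _ hdiv (hA m) (Pt m) (hPt m) ∈
                selmerLocalKer (W.baseChange K) (v.adicCompletion K) ((3 ^ M : ℕ) : ℤ) ↔
              ((3 : ℤ) ^ a) • kolyvaginClass (W.baseChange K) _ hdiv (hA (m / ℓ)) (Pt (m / ℓ))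
                  (hPt (m / ℓ)) ∈
                (W.baseChange K).torsionLocalKer (v.adicCompletion K) ((3 ^ M : ℕ) : ℤ))))) :
    Nat.card (AddCommGroup.primaryComponent (W.baseChange K).sha 3) ≤
      3 ^ (2 * padicValNat 3 (AddSubgroup.zmultiples P).index) := by
  have hndvd : ∀ Q : (W.baseChange K).toAffine.Point, 3 • Q ≠ P :=
    nsmul_ne_of_padicValNat_index_eq_zero hnt Nat.prime_three hidx0 hidx
  have h0 := sha_primary_eq_zero_of_ringClassRationalPointsM_three W hN hρ hK ι hin hsp hTam hKod hnt hndvd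
    hpointsR (@fun _ hM _ hℓ _ ↦ kolyvaginReciprocityM_of_poitouTate_of_conductorNorm W hN hPT
      Nat.prime_three hM hℓ)
  have hbot : AddCommGroup.primaryComponent (W.baseChange K).sha 3 = ⊥ := by
    refine (AddSubgroup.eq_bot_iff_forall _).mpr fun x hx ↦ ?_
    obtain ⟨n, hn⟩ := (AddCommGroup.mem_primaryComponent).1 hx
    exact h0 x ⟨n, hn⟩
  rw [hbot, AddSubgroup.card_bot, hidx, mul_zero, pow_zero]

end Summit.BirchSwinnertonDyer.BirchSwinnertonDyer.Theorems.ShimuraKolyvaginLocalShift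
end
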